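import Summits.RiemannHypothesis.RiemannHypothesis.Theses.WeilWindowFlow
import Literature.NumberTheory.LFunctions.WeilMarkovQuadratic
import Literature.NumberTheory.LFunctions.WeilGroundState
import Literature.NumberTheory.LFunctions.WeilSemilocalCompactness
import HarnessLib.Audit

/-!
# Line `ladder-height-edge-law` — skeleton for crux `WeilWindowFlow.WindowLipschitz`
(item stmt-RiemannHypothesis-1039, route route-RiemannHypothesis-WeilWindowFlow; crux idea card
`Cruxes/WindowLipschitz/Ideas/ladder-height-edge-law.md`, triage r1-1/2/3: pass)

Crux (by name, never restated): `WindowLipschitz` — the window bottom `ε = weilGroundEnergy` is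
one-sidedly Lipschitz on every compact window range `[b₀, A] ⊂ (0, ∞)`.

THE LINE. Weil's form on the window `[-a,a]` is, by the PROVED Markov decomposition
`weilQuadratic_re_eq_weilPoleForm_add_weilDirichletEnergy_sub`,
`Re Q(g) = P(g) + 𝓔_a(g) − M_a ‖g‖²`, whose archimedean part `∫₀^∞ ρ(t) D_t(g) dt`
(`ρ = weilArchDensity`, `D_t = weilIncrement`) is the Dirichlet form of the symmetric Lévy process `Y`
with Lévy density `ρ(|t|) = Σ_{k≥0} e^{-(2k+½)|t|}` and exponent
`ψ_Y(ξ) = 2∫₀^∞ (1 − cos ξt) ρ(t) dt = Re ψ(¼ + iξ/2) − ψ(¼) ~ log|ξ|` (`stub_levySymbol`, the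
dictionary; ψ = digamma). A ground state `u` of window `a` (`IsWeilGroundState a u`) satisfies the weak
Euler–Lagrange equation `𝓔^{arch}(u, φ) = ⟨F, φ⟩` on `D = (−a, a)` with the primes, the rank-2 pole form
and `(ε(a)+M_a)u` moved into the source `F` (`stub_eulerLagrange`), and `‖F‖_∞ ≲ ‖u‖_∞ + 1 ≤ C(b₀,A)`
by eventual ultracontractivity of the archimedean semigroup (`e^{-tψ_Y} ≍ ⟨ξ⟩^{-t} ∈ L¹` iff `t > 1`;
`stub_supBound`). The weak maximum principle for the killed jump form (`stub_greenDomination`) gives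
`|u| ≤ ‖F‖_∞ · w_a`, where `w_a = E_x τ_D` is the torsion function (expected exit time) of `Y` from
`D`, and FLUCTUATION THEORY owns `w_a` sharply: `E_x τ_{(−a,a)} ≤ 2 V(a) V(a − |x|)` for every
symmetric Lévy process with unbounded exponent (Bogdan–Grzywny–Ryznar arXiv:1307.0270 §2, display
before Lemma 2.3), `V` = renewal function of the ascending ladder-height process,
`V(r)² ψ_Y(1/r) ∈ [1/25, 25]` (Kwaśnicki–Małecki–Ryznar arXiv:1103.0935 Thm 4.4), hence
`w_a(x)² log(1/(a−|x|)) ≤ C(A)` at the window edge (`stub_exitTime`, the LOAD-BEARING stub: exponent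
exactly ½, where supersolution methods for order-zero operators stall at every τ < ½,
FJW arXiv:2010.10448 Rem 1.5). Together: the sharp pointwise EDGE LAW
`|u(x)|² log(1/(a−|x|)) ≤ C(b₀,A)` for ground states, uniformly on `[b₀,A]`; the CUT transfer
(`stub_cut`, mechanism of the sibling card `cut-dont-squeeze`: multiply the window-`a` ground state by
a cutoff, pay only the remnant's self-energy `m(h)² · ½log(1/h) = O(h)`) turns it into the one-edge
small-step bound `ε(a−h) ≤ ε(a) + L h` (`h ≤ h₀(b₀,A)`), and the sorry-free glue `WindowLipschitz_of`
chains small steps across `[b, a] ⊆ [b₀, A]` (the disprover's `windowLipschitz_iff_locallyLipschitzOn`: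
local-to-compact glue is free) and concludes the crux BY NAME. Ground states exist by the compactness
of the form embedding (`stub_compactEmbedding` = the statement of the claim-tagged tree fact
`ConnesConsaniMoscovici2025_thm_3_6`, discharged here; existence then is the tree lemma
`ConnesConsaniMoscovici2025_thm_3_6.exists_isWeilGroundState`).

DISPROOF HONOURED (refuter-cdisprove-1039, Disproof.lean evidence 2026-08-15T22:36Z):
`windowLipschitz_false_without_floor` / `lipschitzConstant_unbounded` — the floor `0 < b₀` is used at
`stub_supBound` (`K(b₀,A)` carries `e^{t ε(b₀)}`, `ε(b₀) → ∞` as `b₀ → 0⁺`) and at `stub_eulerLagrange`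
(`|ε(a)| ≤ max(|ε(b₀)|, |ε(A)|)`), so every constant lives on `[b₀, A]` and nothing uniform on `(0,∞)` is
claimed (`not_windowLipschitzUniform`); the near-miss `not_virialBoundedOnNearMinimisers` is avoided:
TRUE ground states only, no dilation virial anywhere. `ledger negatives --problem RiemannHypothesis`: none.

All stub signatures are written over existing Literature / Mathlib declarations only (no local
definitions), so each stub can land as a pure-proof helper under `Theorems/` (`--supports` the crux).
Inline dictionary used below:
* `archForm u φ`  := `∫ t in Ioi 0, (ρ t : ℂ) * ∫ x, (u (x+t) − u x) * conj (φ (x+t) − φ x)`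
  (sesquilinear archimedean energy; `archForm g g = ∫ ρ D_t(g)`);
* `Torsion a w`   := `w ≥ 0`, `w = 0` off `Ioo (−a) a`, `w` bounded, `(w : ℂ) ∈ L²`, finite
  archimedean energy, and `archForm w φ = ∫ conj φ` for every Weil test `φ` on the window
  (the weak torsion problem `L_Y w = 1` in `D`, `w = 0` outside; its solution is `E_x τ_D`).
-/

noncomputable section

open MeasureTheory Set Filter
open scoped Topology ComplexConjugate

namespace Summit.RiemannHypothesis.RiemannHypothesis.Cruxes.WindowLipschitz.LadderHeightEdgeLaw

open Literature.NumberTheory.LFunctions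
open Summit.RiemannHypothesis.RiemannHypothesis.Theses.WeilWindowFlow (WindowLipschitz)

/-! ### The seven registered stubs -/

/-- **Stub 1 — the Lévy dictionary (symbol of the archimedean form).** For every Weil test function
`g`, `∫₀^∞ ρ(t) D_t(g) dt = (1/2π) ∫ |ĝ(½ + iξ)|² (Re ψ(¼ + iξ/2) − ψ(¼)) dξ`: Plancherel for the
translates (`D_t(g) = (1/2π)∫|ĝ|² · 2(1 − cos ξt)`), Tonelli, and the termwise computation
`2∫₀^∞(1 − cos ξt) e^{-ct} dt = 2ξ²/(c(c²+ξ²))`, `c = 2k + ½`, summed against the partial fractions of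
the digamma function. So the archimedean energy is the Dirichlet form of a symmetric Lévy process with
exponent `ψ_Y = Re ψ(¼ + i·/2) − ψ(¼) = log|ξ| − log 2 − ψ(¼) + O(ξ⁻²)`. Provable now (M); verified
termwise by all three triagers. Feeds Stubs 2, 3 and 6. -/
theorem stub_levySymbol :
    ∀ g : ℝ → ℂ, IsWeilTest g →
      ∫ t in Ioi (0 : ℝ), weilArchDensity t * weilIncrement g t =
        1 / (2 * Real.pi) * ∫ ξ : ℝ, ‖weilMellin g (1 / 2 + (ξ : ℂ) * Complex.I)‖ ^ 2 *
          ((Complex.digamma (1 / 4 + (ξ : ℂ) / 2 * Complex.I)).re - (Complex.digamma (1 / 4)).re) := by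
  sorry

/-- **Stub 2 — compactness of the window form embedding (⇒ ground states exist).** Every
`L²`-normalised sequence of Weil test functions on a fixed window with bounded form values has an
`L²`-convergent subsequence. This is LITERALLY the statement of the claim-tagged tree fact
`ConnesConsaniMoscovici2025_thm_3_6` (CCM25 Thm 3.6 with Prop 3.5: discrete spectrum ⇔ compact form
embedding; Bombieri2000Weil Thm 3 proves attainment directly), here to be PROVED (M): bounded `Re Q`
⇒ bounded `𝓔_a` (Markov decomposition, `|P(g)| ≤ C(a)‖g‖₂²`) ⇒ by Stub 1 `∫|ĝ|² ψ_Y ≤ C` with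
`ψ_Y → ∞`, i.e. uniformly small high frequencies, while `supp g ⊆ [-a,a]` makes `{ĝₙ}` equicontinuous
and bounded — Fourier-side Rellich/Kolmogorov–Riesz. Existence of ground states is then the tree lemma
`ConnesConsaniMoscovici2025_thm_3_6.exists_isWeilGroundState`. -/
theorem stub_compactEmbedding :
    (∀ g : ℝ → ℂ, IsWeilTest g →
      ∫ t in Ioi (0 : ℝ), weilArchDensity t * weilIncrement g t =
        1 / (2 * Real.pi) * ∫ ξ : ℝ, ‖weilMellin g (1 / 2 + (ξ : ℂ) * Complex.I)‖ ^ 2 *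
          ((Complex.digamma (1 / 4 + (ξ : ℂ) / 2 * Complex.I)).re - (Complex.digamma (1 / 4)).re)) →
    ∀ a : ℝ, 0 < a → ∀ g : ℕ → ℝ → ℂ,
      (∀ n, IsWeilTest (g n) ∧ tsupport (g n) ⊆ Icc (-a) a ∧ ∫ t, ‖g n t‖ ^ 2 = (1 : ℝ)) →
      BddAbove (Set.range fun n => (weilQuadratic (g n)).re) →
        ∃ u : ℝ → ℂ, MemLp u 2 ∧ ∃ φ : ℕ → ℕ, StrictMono φ ∧
          Tendsto (fun n => ∫ t, ‖g (φ n) t - u t‖ ^ 2) atTop (𝓝 0) := by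
  sorry

/-- **Stub 3 — uniform sup bound of ground states (eventual ultracontractivity).** On every compact
window range `[b₀, A]` all ground states are essentially bounded by one constant `K(b₀, A)`.
Mechanism: `u` is a normalised bottom eigenvector of the Friedrichs operator `H_a` of the window form,
so `u = e^{tε(a)} e^{-tH_a} u` and `‖u‖_∞ ≤ e^{tε(a)} ‖e^{-tH_a}‖_{2→∞}`; the killed archimedean+prime
jump semigroup is dominated by the free one, whose heat kernel `p_t(0) = (1/2π)∫ e^{-tψ_Y} < ∞` iff
`t > 1` (Stub 1: `ψ_Y = log|ξ| + O(1)`), and the rank-2 pole operator (`L² → L^∞` on the window) enters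
through a Dyson/Duhamel series; `ε(a) ≤ ε(b₀) < ∞` and `M_a ≤ M_A` make it uniform on `[b₀, A]`
(and blow up as `b₀ → 0⁺`, as the disprover's `lipschitzConstant_unbounded` demands). Log-Laplacian
analogue in print: FJW arXiv:2010.10448 Thm 1.1 / Cor 1.4 (Dirichlet eigenfunctions are `L^∞`).
Size L (semigroup domination + Fourier heat kernel; no order-zero elliptic bootstrap exists). -/
theorem stub_supBound :
    (∀ g : ℝ → ℂ, IsWeilTest g →
      ∫ t in Ioi (0 : ℝ), weilArchDensity t * weilIncrement g t =
        1 / (2 * Real.pi) * ∫ ξ : ℝ, ‖weilMellin g (1 / 2 + (ξ : ℂ) * Complex.I)‖ ^ 2 *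
          ((Complex.digamma (1 / 4 + (ξ : ℂ) / 2 * Complex.I)).re - (Complex.digamma (1 / 4)).re)) →
    ∀ b₀ A : ℝ, 0 < b₀ → b₀ ≤ A → ∃ K : ℝ, ∀ (a : ℝ) (u : ℝ → ℂ), b₀ ≤ a → a ≤ A →
      IsWeilGroundState a u → ∀ᵐ x : ℝ, ‖u x‖ ≤ K := by
  sorry

/-- **Stub 4 — weak Euler–Lagrange equation in Green-ready form, with bounded source.** A ground
state `u` of window `a ∈ [b₀, A]` has finite archimedean energy, and for every Weil test `φ` on the
window `archForm u φ = ⟨F, φ⟩` with the explicit source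
`F = 1_D · [(ε(a) + M_a) u − Σ_{log n<2a} Λ(n) n^{-1/2} (2u − u(·+log n) − u(·−log n)) − Polar u]`,
`Polar u = 2(∫ u cosh(t/2)) cosh(x/2) − 2(∫ u sinh(t/2)) sinh(x/2)`, so `‖F‖_∞ ≤ C_F(b₀,A)(K + 1)`
whenever `|u| ≤ K` a.e. (`|ε(a)| ≤ max(|ε(b₀)|, |ε(A)|)` by antitonicity, `M_a ≤ M_A`, `‖u‖₂ = 1`).
Proof (M, operator-free): for a minimising sequence `gₙ → u` and a window test `φ`,
`Re Q(gₙ + sφ) ≥ ε(a)‖gₙ + sφ‖²` for all real `s` (definition of `ε`); expand with the polarised Markov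
decomposition, pass `n → ∞` using `archForm(g, φ) = ⟨g, L_Y φ⟩` with `L_Y φ ∈ L^∞` (and likewise for
the prime and polar parts), read off the vanishing of the linear coefficient, repeat with `iφ`. Finite
energy: `D_t(gₙ) → D_t(u)` and Fatou. (Bombieri2000Weil §4 Lemma 1 / (4.2) is the `L²`-class analogue.) -/
theorem stub_eulerLagrange :
    ∀ b₀ A : ℝ, 0 < b₀ → b₀ ≤ A → ∃ C_F : ℝ, 0 ≤ C_F ∧
      ∀ (a K : ℝ) (u : ℝ → ℂ), b₀ ≤ a → a ≤ A → IsWeilGroundState a u → 0 ≤ K →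
        (∀ᵐ x : ℝ, ‖u x‖ ≤ K) →
        IntegrableOn (fun t : ℝ => weilArchDensity t * weilIncrement u t) (Ioi 0) ∧
        ∃ F : ℝ → ℂ, AEStronglyMeasurable F volume ∧ (∀ᵐ x : ℝ, ‖F x‖ ≤ C_F * (K + 1)) ∧
          ∀ φ : ℝ → ℂ, IsWeilTest φ → tsupport φ ⊆ Icc (-a) a →
            (∫ t in Ioi (0 : ℝ), ((weilArchDensity t : ℝ) : ℂ) *
                ∫ x : ℝ, (u (x + t) - u x) * conj (φ (x + t) - φ x)) =
              ∫ x : ℝ, F x * conj (φ x) := by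
  sorry

/-- **Stub 5 — Green domination (weak maximum principle for the killed archimedean jump form).**
If `u ∈ L²`, `u = 0` a.e. off `[-a, a]`, `u` has finite archimedean energy and solves
`archForm u φ = ⟨F, φ⟩` for all window tests `φ` with `‖F‖ ≤ M` a.e., and `w` solves the torsion
problem `archForm w φ = ⟨1, φ⟩` (`Torsion a w`), then `|u| ≤ M · w` a.e. Proof (M/L): for each phase
`θ`, `v = Re(e^{-iθ} u) − M w` satisfies `archForm(v, φ) ≤ 0` for window tests `φ ≥ 0`; smooth window
tests are dense in the killed form domain (Chen–Weth arXiv:1710.03416 Thm 3.1-type density for the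
`1/|x−y|`-singular kernel on an interval), so one may test with `v₊`; the Markov property of the jump
form (`(p−q)(p₊−q₊) ≥ (p₊−q₊)²`, cf. `weilDirichletEnergy_comp_le`) and coercivity
(killing rate `≥ 2∫_{2a}^∞ ρ > 0`) force `v₊ = 0`; a countable dense set of phases gives `|u| ≤ M w`.
Probabilistically: `u = G_D F`, `|G_D F| ≤ ‖F‖_∞ G_D 1 = ‖F‖_∞ E_x τ_D`. -/
theorem stub_greenDomination :
    ∀ (a M : ℝ) (u F : ℝ → ℂ) (w : ℝ → ℝ), 0 < a →
      MemLp u 2 volume →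
      (∀ᵐ x : ℝ, x ∉ Icc (-a) a → u x = 0) →
      IntegrableOn (fun t : ℝ => weilArchDensity t * weilIncrement u t) (Ioi 0) →
      AEStronglyMeasurable F volume →
      (∀ᵐ x : ℝ, ‖F x‖ ≤ M) →
      (∀ φ : ℝ → ℂ, IsWeilTest φ → tsupport φ ⊆ Icc (-a) a →
        (∫ t in Ioi (0 : ℝ), ((weilArchDensity t : ℝ) : ℂ) *
            ∫ x : ℝ, (u (x + t) - u x) * conj (φ (x + t) - φ x)) =
          ∫ x : ℝ, F x * conj (φ x)) →
      ((∀ x : ℝ, 0 ≤ w x) ∧ (∀ x : ℝ, x ∉ Ioo (-a) a → w x = 0) ∧ (∃ B : ℝ, ∀ x : ℝ, w x ≤ B) ∧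
        MemLp (fun x : ℝ => ((w x : ℝ) : ℂ)) 2 volume ∧
        IntegrableOn (fun t : ℝ => weilArchDensity t * weilIncrement (fun x : ℝ => ((w x : ℝ) : ℂ)) t)
          (Ioi 0) ∧
        ∀ φ : ℝ → ℂ, IsWeilTest φ → tsupport φ ⊆ Icc (-a) a →
          (∫ t in Ioi (0 : ℝ), ((weilArchDensity t : ℝ) : ℂ) *
              ∫ x : ℝ, (((w (x + t) : ℝ) : ℂ) - ((w x : ℝ) : ℂ)) * conj (φ (x + t) - φ x)) =
            ∫ x : ℝ, conj (φ x)) →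
      ∀ᵐ x : ℝ, ‖u x‖ ≤ M * w x := by
  sorry

/-- **Stub 6 — LOAD-BEARING: the torsion function and its sharp edge profile (exit time of the
archimedean Lévy process; ladder-height renewal function).** For every `A` there are `C, d₀` such that
for every window `0 < a ≤ A` the torsion problem on `D = (−a, a)` has a solution `w` (`Torsion a w`:
Lax–Milgram in the killed form domain, coercive with constant `2∫_{2a}^∞ ρ`; `0 ≤ w ≤ 1/(2∫_{2a}^∞ρ)`
by comparison with `1_D`, which has finite energy for this order-zero form) with
`w(x)² log(1/(a − |x|)) ≤ C` a.e. on the edge layer `a − d₀ < |x| < a`. Intended proof — fluctuation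
theory with the dictionary of Stub 1: `w = E_x τ_D` (part process ↔ part form, Fukushima–Oshima–Takeda
§4.4 / Chen–Fukushima §3.3), `E_x τ_{(−a,a)} ≤ 2 V(a) V(a − |x|)` for every symmetric Lévy process on
`ℝ` with unbounded exponent (Bogdan–Grzywny–Ryznar arXiv:1307.0270 §2, display before Lemma 2.3;
Grzywny–Ryznar arXiv:1107.0745 Prop 3.5), `V` the renewal function of the ladder-height process,
harmonic for the process killed on leaving the half-line (Silverstein 1980), and
`1/5 ≤ V(r) √(ψ_Y(1/r)) ≤ 5` (Kwaśnicki–Małecki–Ryznar arXiv:1103.0935 Thm 4.4: `ψ_Y` and `ξ²/ψ_Y`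
increasing — true termwise for `ψ_Y = Σ 2ξ²/(c_k(c_k²+ξ²))`), with `ψ_Y(1/r) = log(1/r) − log 2 − ψ(¼) + o(1)`;
the Wiener–Hopf factor `κ(λ) = exp((1/π)∫₀^∞ λ log ψ_Y(ξ)/(λ²+ξ²) dξ)` (Fristedt; KMR13 Cor 9.7) is what
holds the endpoint exponent `½` that supersolutions of order-zero operators miss (FJW Rem 1.5: every
τ < ½). Model case in print: Hernández-Santamaría–López-Ríos–Saldaña arXiv:2401.18033 Thm 1.2
(torsion function of the logarithmic Laplacian `≍ ℓ^{1/2}(dist)`, exponent optimal). Size L; no Lévy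
fluctuation theory in Mathlib (alternative self-contained engine: the two-scale barrier of the sibling
card `borderline-barrier`, which proves the same statement). -/
theorem stub_exitTime :
    (∀ g : ℝ → ℂ, IsWeilTest g →
      ∫ t in Ioi (0 : ℝ), weilArchDensity t * weilIncrement g t =
        1 / (2 * Real.pi) * ∫ ξ : ℝ, ‖weilMellin g (1 / 2 + (ξ : ℂ) * Complex.I)‖ ^ 2 *
          ((Complex.digamma (1 / 4 + (ξ : ℂ) / 2 * Complex.I)).re - (Complex.digamma (1 / 4)).re)) →
    ∀ A : ℝ, ∃ C d₀ : ℝ, 0 ≤ C ∧ 0 < d₀ ∧ d₀ < 1 ∧ ∀ a : ℝ, 0 < a → a ≤ A →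
      ∃ w : ℝ → ℝ,
        ((∀ x : ℝ, 0 ≤ w x) ∧ (∀ x : ℝ, x ∉ Ioo (-a) a → w x = 0) ∧ (∃ B : ℝ, ∀ x : ℝ, w x ≤ B) ∧
          MemLp (fun x : ℝ => ((w x : ℝ) : ℂ)) 2 volume ∧
          IntegrableOn (fun t : ℝ => weilArchDensity t * weilIncrement (fun x : ℝ => ((w x : ℝ) : ℂ)) t)
            (Ioi 0) ∧
          ∀ φ : ℝ → ℂ, IsWeilTest φ → tsupport φ ⊆ Icc (-a) a →
            (∫ t in Ioi (0 : ℝ), ((weilArchDensity t : ℝ) : ℂ) *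
                ∫ x : ℝ, (((w (x + t) : ℝ) : ℂ) - ((w x : ℝ) : ℂ)) * conj (φ (x + t) - φ x)) =
              ∫ x : ℝ, conj (φ x)) ∧
        ∀ᵐ x : ℝ, a - d₀ < |x| → |x| < a → w x ^ 2 * Real.log (1 / (a - |x|)) ≤ C := by
  sorry

/-- **Stub 7 — the CUT transfer (one-edge collar, small steps).** From existence of ground states,
the uniform sup bound and the sharp pointwise EDGE LAW (exponent ½, uniform on `[b₀, A]`):
`ε(a − h) ≤ ε(a) + L h` for `0 < h ≤ h₀(b₀, A)`, `b₀ ≤ a − h`, `a ≤ A`. Mechanism (sibling card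
`cut-dont-squeeze`, triage-sharpened): `Q` is translation invariant, so `ε` depends only on the window
length and a collar at ONE edge compares `ε(a−h)` with `ε(a)`; multiply the window-`a` ground state `u`
by a cutoff `χ` vanishing on the collar — `B := Re Q̄ − ε(a)‖·‖² ⪰ 0` on window-`a` functions and the
E–L equation kills the cross term (IMS / ground-state substitution: `B(χu) = ½∬ u(x)ū(y)(χ_x−χ_y)² ν_A`
plus an `O(h)` rank-2 polar remainder), so `(ε(a−h) − ε(a))‖χu‖² ≤ B((1−χ)u)`; with the edge law on
BOTH factors the archimedean commutator is `√(log 1/h) · ∫₀^{2h}(log 1/σ)^{-1/2}dσ = O(h)` (the two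
half-powers of `log` cancel exactly at exponent ½; any τ < ½ gives `h(log 1/h)^{1−2τ}`), the killing of
the remnant is `m(h)²(½log(1/h) + O(1)) = O(h)`, prime atoms cost `O(h‖u‖_∞²)` (sup bound), and
`‖χu‖² ≥ ½` for `h ≤ h₀`; smooth window tests are a form core, so `ε(a−h) ≤ B̄`-Rayleigh quotient of
`χu`. Numerics: j005651, cut-cost/h flat over six decades. Size L. -/
theorem stub_cut :
    (∀ a : ℝ, 0 < a → ∃ u : ℝ → ℂ, IsWeilGroundState a u) →
    (∀ b₀ A : ℝ, 0 < b₀ → b₀ ≤ A → ∃ K : ℝ, ∀ (a : ℝ) (u : ℝ → ℂ), b₀ ≤ a → a ≤ A →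
      IsWeilGroundState a u → ∀ᵐ x : ℝ, ‖u x‖ ≤ K) →
    (∀ b₀ A : ℝ, 0 < b₀ → b₀ ≤ A → ∃ C d₀ : ℝ, 0 < d₀ ∧ d₀ < 1 ∧
      ∀ (a : ℝ) (u : ℝ → ℂ), b₀ ≤ a → a ≤ A → IsWeilGroundState a u →
        ∀ᵐ x : ℝ, a - d₀ < |x| → |x| < a → ‖u x‖ ^ 2 * Real.log (1 / (a - |x|)) ≤ C) →
    ∀ b₀ A : ℝ, 0 < b₀ → b₀ ≤ A → ∃ L h₀ : ℝ, 0 < h₀ ∧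
      ∀ a h : ℝ, b₀ ≤ a - h → a ≤ A → 0 < h → h ≤ h₀ →
        weilGroundEnergy (a - h) - weilGroundEnergy a ≤ L * h := by
  sorry

/-! ### Sorry-free glue -/

/-- Chaining small steps: if every step of length `≤ h₀` inside `[b₀, A]` costs at most `L` per unit
length, then so does every pair `b ≤ a` in `[b₀, A]` (induction on the number of steps; no
monotonicity of `ε` is needed). -/
theorem le_of_smallSteps {ε : ℝ → ℝ} {b₀ A L h₀ : ℝ} (hh₀ : 0 < h₀)
    (hstep : ∀ a h : ℝ, b₀ ≤ a - h → a ≤ A → 0 < h → h ≤ h₀ → ε (a - h) - ε a ≤ L * h) :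
    ∀ n : ℕ, ∀ b a : ℝ, b₀ ≤ b → b ≤ a → a ≤ A → a - b ≤ n * h₀ → ε b - ε a ≤ L * (a - b) := by
  intro n
  induction n with
  | zero =>
    intro b a hb hba haA hn
    have hab : a = b := by
      simp only [Nat.cast_zero, zero_mul] at hn
      linarith
    subst hab
    simp
  | succ n ih =>
    intro b a hb hba haA hn
    by_cases hsmall : a - b ≤ h₀
    · rcases eq_or_lt_of_le hba with heq | hlt
      · subst heq
        simp
      · have h1 := hstep a (a - b) (by linarith) haA (by linarith) hsmall
        have e : a - (a - b) = b := by ring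
        rw [e] at h1
        exact h1
    · have hlt : h₀ < a - b := not_le.mp hsmall
      have hc : b + h₀ ≤ a := by linarith
      have h1 := hstep (b + h₀) h₀ (by linarith) (by linarith) hh₀ le_rfl
      have e : b + h₀ - h₀ = b := by ring
      rw [e] at h1
      have hn' : a - (b + h₀) ≤ n * h₀ := by
        push_cast at hn
        linarith
      have h2 := ih (b + h₀) a (by linarith) hc haA hn'
      have e1 : ε b - ε a = (ε b - ε (b + h₀)) + (ε (b + h₀) - ε a) := by ring
      have e2 : L * (a - b) = L * h₀ + L * (a - (b + h₀)) := by ring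
      rw [e1, e2]
      exact add_le_add h1 h2

/-! ### The composition (concludes the crux BY NAME) -/

/-- **`WindowLipschitz` from the seven stubs.** Existence (Stub 2 + tree lemma) and the sup bound
(Stub 3) feed the engine; the EDGE LAW is assembled from Stubs 3–6 (`|u| ≤ M w`, `M = C_F (K+1)`,
`w² log(1/d) ≤ C_w`, hence `|u|² log(1/d) ≤ M² C_w` a.e. on the layer); Stub 7 turns it into small
one-edge steps, and `le_of_smallSteps` chains them over `[b, a] ⊆ [b₀, A]` (Archimedes supplies the
number of steps). -/
theorem WindowLipschitz_of : WindowLipschitz := by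
  -- (i) ground states exist: compact form embedding (Stub 2, via the dictionary Stub 1) + tree lemma
  have hex : ∀ a : ℝ, 0 < a → ∃ u : ℝ → ℂ, IsWeilGroundState a u := fun a ha =>
    ConnesConsaniMoscovici2025_thm_3_6.exists_isWeilGroundState
      (stub_compactEmbedding stub_levySymbol) ha
  -- (ii) uniform sup bound (Stub 3)
  have hsup := stub_supBound stub_levySymbol
  -- (iii) the sharp pointwise edge law, assembled from Stubs 3, 4, 5, 6
  have hedge : ∀ b₀ A : ℝ, 0 < b₀ → b₀ ≤ A → ∃ C d₀ : ℝ, 0 < d₀ ∧ d₀ < 1 ∧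
      ∀ (a : ℝ) (u : ℝ → ℂ), b₀ ≤ a → a ≤ A → IsWeilGroundState a u →
        ∀ᵐ x : ℝ, a - d₀ < |x| → |x| < a → ‖u x‖ ^ 2 * Real.log (1 / (a - |x|)) ≤ C := by
    intro b₀ A hb₀ hbA
    obtain ⟨K, hK⟩ := hsup b₀ A hb₀ hbA
    obtain ⟨CF, hCF0, hEL⟩ := stub_eulerLagrange b₀ A hb₀ hbA
    obtain ⟨Cw, d₀, hCw0, hd₀, hd₁, hW⟩ := stub_exitTime stub_levySymbol A
    refine ⟨(CF * (max K 0 + 1)) ^ 2 * Cw, d₀, hd₀, hd₁, ?_⟩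
    intro a u ha haA hu
    have ha0 : 0 < a := lt_of_lt_of_le hb₀ ha
    have hKu : ∀ᵐ x : ℝ, ‖u x‖ ≤ max K 0 :=
      (hK a u ha haA hu).mono fun x hx => hx.trans (le_max_left _ _)
    obtain ⟨hfin, F, hFm, hFb, hweak⟩ := hEL a (max K 0) u ha haA hu (le_max_right _ _) hKu
    obtain ⟨w, hw, hprof⟩ := hW a ha0 haA
    have hdom := stub_greenDomination a (CF * (max K 0 + 1)) u F w ha0 hu.memLp
      hu.ae_eq_zero_of_notMem hfin hFm hFb hweak hw
    filter_upwards [hdom, hprof] with x hx hpx hlo hhi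
    have hδ : 0 < a - |x| := by linarith
    have hlog : 0 ≤ Real.log (1 / (a - |x|)) := by
      apply Real.log_nonneg
      rw [le_div_iff₀ hδ]
      linarith
    have hsq : ‖u x‖ ^ 2 ≤ (CF * (max K 0 + 1) * w x) ^ 2 :=
      pow_le_pow_left₀ (norm_nonneg _) hx 2
    calc ‖u x‖ ^ 2 * Real.log (1 / (a - |x|))
        ≤ (CF * (max K 0 + 1) * w x) ^ 2 * Real.log (1 / (a - |x|)) :=
          mul_le_mul_of_nonneg_right hsq hlog
      _ = (CF * (max K 0 + 1)) ^ 2 * (w x ^ 2 * Real.log (1 / (a - |x|))) := by ring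
      _ ≤ (CF * (max K 0 + 1)) ^ 2 * Cw :=
          mul_le_mul_of_nonneg_left (hpx hlo hhi) (sq_nonneg _)
  -- (iv) the cut transfer: small one-edge steps (Stub 7)
  have hstep := stub_cut hex hsup hedge
  -- (v) chain the steps across [b, a] ⊆ [b₀, A]
  intro b₀ A hb₀ hbA
  obtain ⟨L, h₀, hh₀, hst⟩ := hstep b₀ A hb₀ hbA
  refine ⟨L, fun b a hb hba haA => ?_⟩
  obtain ⟨n, hn⟩ : ∃ n : ℕ, a - b ≤ n * h₀ := by
    obtain ⟨n, hn⟩ := exists_nat_ge ((a - b) / h₀)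
    exact ⟨n, by rwa [div_le_iff₀ hh₀] at hn⟩
  exact le_of_smallSteps hh₀ hst n b a hb hba haA hn

end Summit.RiemannHypothesis.RiemannHypothesis.Cruxes.WindowLipschitz.LadderHeightEdgeLaw

end
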